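import Literature.AnabelianGeometry.SemiGraphs.TemperedCyclotomic
import Literature.AnabelianGeometry.SemiGraphs.TemperedCyclotomicInnerModel
import HarnessLib

/-!
# [EtTh] §1 p. 238 — the cyclotomic identifications `Δ_Θ ≅ Ẑ(1)`, `1 → Ẑ(1) → Δ^ell_X → Ẑ → 1`,
# `(Δ^tp_Y)^ell ≅ Ẑ(1)` as typed: `Δ^tp_X` acts trivially (every `D`); the universal closures over the
# origin binder are REFUTED; instance forms (FACT-LIST rows F-0657, F-0658, F-0659, F-1697, abc-iut cell)

Mochizuki, *The étale theta function and its Frobenioid-theoretic manifestations*, Publ. RIMS **45**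
(2009) [EtTh], §1, PRIMS p. 238 [cite: MochizukiEtTh2009, §1 p.238]: "Then we have a natural exact sequence
`1 → Ẑ(1) → Δ^ell_X → Ẑ → 1` … `1 → ∧² Δ^ell_X (≅ Ẑ(1)) → Δ^Θ_X → Δ^ell_X → 1` … Let us denote the image
of `∧² Δ^ell_X` in `Δ^Θ_X` by `(Ẑ(1) ≅) Δ_Θ ⊆ Δ^Θ_X`. … Thus, `(Δ^tp_Y)^ell ≅ Ẑ(1)`".

abc-iut-L3 typed these (`TemperedCyclotomic.lean`, p406555) as PREDICATES on the origin hypothesis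
`Ω : TemperedPiOrigin K` ("assumed by consumers, asserted for no instance"):
`OncePuncturedTemperedGroup.DeltaEllExtension Ω` (F-0657), `.DeltaThetaIsoTate Ω` (F-0658),
`.DeltaYEllIsoTate Ω` (F-0659), `.DeltaYEllClosureIsoTate Ω` (F-1697), each of the shape
`∀ D, Ω.IsTateOrigin D → IsTateTwist …` with `IsTateTwist T act` = "`T`, with the `Π^tp_X`-action `act`,
is `Ẑ(1) = lim_n μ_n(K̄)` as a `G_K`-module, level-wise" (compatible, jointly injective, `aug`-EQUIVARIANT
continuous surjections `T ↠ μ_n(K̄)`).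

PROOF-ONLY file (abc-iut cell, block C / W6 seat abc-iut-w6-d060, F-TRANCHES 171/172; no definition, no
instance, no named fact). Contents:

1. **Structure theorems for EVERY `D : OncePuncturedTemperedGroup K`** (positive content): an element
   `g ∈ Π^tp_X` whose conjugation action on `Δ_X` is INNER acts trivially on `Δ_Θ`
   (`conjDeltaThetaX_eq_self_of_inner`, via `conj_mem_doubleCommutator`:
   `[Δ_X, [Δ_X, Δ_X]⁻] ⊆ [Δ_X, [Δ_X, Δ_X]]⁻`, i.e. `Δ_Θ` is central), on `Δ^ell_X`
   (`conjDeltaEll_eq_self_of_inner`) and on `(Δ^tp_X)^ell ⊆ (Π^tp_X)^ell`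
   (`conjPiEll_eq_self_of_inner`); hence **`Δ^tp_X` acts trivially on `Δ_Θ`, `Δ^ell_X`, `(Δ^tp_X)^ell`**
   (`…_of_mem_delta`) — the kernel form of "the conjugation action of `Π^tp_X` [on these subquotients]
   factors through `Π^tp_X/Δ^tp_X = G_K`", the sentence under which p. 238 speaks of `G_K`-modules.
2. `not_isTateTwist_of_forall_eq` — a `Π^tp_X`-FIXED `T` is never a Tate twist once some `σ ∈ G_K` moves a
   root of unity (surjectivity + equivariance of `ι_n`).
3. **The universal closures are FALSE** (`not_forall_deltaThetaIsoTate`, `not_forall_deltaEllExtension`,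
   `not_forall_deltaYEllIsoTate`, `not_forall_deltaYEllClosureIsoTate`, with `exists_not_…` forms at
   `K = ℚ₃`): the ALL-TRUE origin hypothesis declares the product model `Π = (F̂₂ ×_Ẑ ℤ) × G_{ℚ₃}` of
   `OncePuncturedTemperedGroupPadicWitness.lean` (re-assembled with its inner-action certificate in
   `TemperedCyclotomicInnerModel.lean`) to be `Π^tp_X`; there all of `Π^tp_X` acts on `Δ_X` by inner
   automorphisms, hence trivially on `Δ_Θ`, `Δ^ell_X`, `(Δ^tp_X)^ell`, while `G_{ℚ₃}` moves `i ∈ μ₄(Q̄₃)`.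
   So each predicate is a SCHEMA over the lawless binder `Ω` (cell rule R5: consumed AT NAMED INSTANCES
   only) — exactly as the typer's docstring of `TemperedPiOrigin` anticipated ("can be neither discharged
   nor refuted from junk data until a construction of `π₁^temp` supplies the intended `Ω`": the universal
   closure IS refutable from junk data; the intended instance is not).
4. **Instance forms**: each predicate holds at every `Ω` with no Tate-origin datum (vacuous;
   `…_of_forall_not_isTateOrigin`). Honest label: no tempered fundamental group is constructed in the tree,
   so no non-vacuous instance exists; the kernel-visible obstruction of item 3 says moreover that the cell's
   `ℚ_p` consistency witness could NOT serve as one.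

HONEST FRAMING: statements about OUR typed predicates and OUR witness data; nothing of [EtTh]/[SemiAnbd]
is asserted or refuted; no side is taken on [IUTchIII] Cor. 3.12 or any disputed claim; typed ≠ proved.
-/

open Topology

noncomputable section

namespace Literature.AnabelianGeometry.SemiGraphs

namespace OncePuncturedTemperedGroup

universe u

variable {K : Type u} [Field K] (D : OncePuncturedTemperedGroup K)

/-! ### `Δ_Θ` is central; inner actions are trivial on `Δ_Θ`, `Δ^ell_X`, `(Δ^tp_X)^ell` -/

/-- **`[Δ_X, [Δ_X, Δ_X]⁻] ⊆ [Δ_X, [Δ_X, Δ_X]]⁻`, elementwise**: for `d ∈ Δ_X` and `y` in the CLOSED commutator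
subgroup `[Δ_X, Δ_X]⁻`, the commutator `d y d⁻¹ y⁻¹` lies in the closed double commutator
`[Δ_X, [Δ_X, Δ_X]]⁻` (the continuous map `y ↦ ⁅d, y⁆` carries `[Δ_X, Δ_X]` into `[Δ_X, [Δ_X, Δ_X]]`, hence
closures into closures). This is why `Δ_Θ = Im([Δ_X, Δ_X]⁻ → Δ^Θ_X)` is central for the inner action
([EtTh] §1 p. 238: "`1 → ∧² Δ^ell_X (≅ Ẑ(1)) → Δ^Θ_X → Δ^ell_X → 1`" is a central extension).
[cite: MochizukiEtTh2009, §1 p.238] -/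
theorem conj_mem_doubleCommutator {d y : D.PiHat} (hd : d ∈ D.deltaHat) (hy : y ∈ D.ellKerHat) :
    d * y * d⁻¹ * y⁻¹ ∈ D.doubleCommutator := by
  -- the continuous map `y ↦ ⁅d, y⁆` carries `[Δ̂, Δ̂]` into `[Δ̂, [Δ̂, Δ̂]]`, hence closures into closures
  let φ : D.PiHat → D.PiHat := fun y => d * y * d⁻¹ * y⁻¹
  have hφ : Continuous φ := by fun_prop
  have hsub : φ '' ((⁅D.deltaHat, D.deltaHat⁆ : Subgroup D.PiHat) : Set D.PiHat) ⊆
      (D.doubleCommutator : Set D.PiHat) := by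
    rintro _ ⟨s, hs, rfl⟩
    exact Subgroup.le_topologicalClosure _ (Subgroup.commutator_mem_commutator hd hs)
  have hy' : y ∈ closure (((⁅D.deltaHat, D.deltaHat⁆ : Subgroup D.PiHat) : Set D.PiHat)) := by
    rw [← Subgroup.topologicalClosure_coe]; exact hy
  have h1 : φ y ∈ closure (φ '' ((⁅D.deltaHat, D.deltaHat⁆ : Subgroup D.PiHat) : Set D.PiHat)) :=
    image_closure_subset_closure_image hφ ⟨y, hy', rfl⟩
  have hcl : IsClosed (D.doubleCommutator : Set D.PiHat) := Subgroup.isClosed_topologicalClosure _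
  have h2 : φ y ∈ closure (D.doubleCommutator : Set D.PiHat) := closure_mono hsub h1
  rwa [hcl.closure_eq] at h2

/-- **An element of `Π^tp_X` whose conjugation action on `Δ_X` is inner (by some `d ∈ Δ_X`) acts
TRIVIALLY on `Δ_Θ ⊆ Δ^Θ_X`** — `Δ_Θ` is central in `Δ^Θ_X = Δ_X/[Δ_X, [Δ_X, Δ_X]]⁻` for the action of
`Δ_X` (`conj_mem_doubleCommutator`). [cite: MochizukiEtTh2009, §1 p.238] -/
theorem conjDeltaThetaX_eq_self_of_inner (g : D.Pi) (d : D.deltaHat)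
    (hd : ∀ h : D.deltaHat, D.toHat g * (h : D.PiHat) * (D.toHat g)⁻¹ = d * h * (d : D.PiHat)⁻¹)
    {t : D.DeltaThetaX} (ht : t ∈ D.deltaTheta) : D.conjDeltaThetaX g t = t := by
  obtain ⟨y, hy, rfl⟩ := ht
  change QuotientGroup.map _ _ (D.conjDeltaHat g).toMonoidHom _ (QuotientGroup.mk y) = QuotientGroup.mk y
  rw [QuotientGroup.map_mk, QuotientGroup.eq, Subgroup.mem_subgroupOf]
  have hcoe : ((D.conjDeltaHat g).toMonoidHom y : D.PiHat) = d * y * (d : D.PiHat)⁻¹ := by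
    rw [MulEquiv.coe_toMonoidHom, coe_conjDeltaHat, hd]
  have hy' : ((y : D.PiHat))⁻¹ ∈ D.ellKerHat := D.ellKerHat.inv_mem (Subgroup.mem_subgroupOf.mp hy)
  have key := D.conj_mem_doubleCommutator d.2 hy'
  rw [inv_inv] at key
  -- `(d y d⁻¹)⁻¹ * y = d y⁻¹ d⁻¹ y`
  rw [Subgroup.coe_mul, Subgroup.coe_inv, hcoe]
  simpa [mul_inv_rev, mul_assoc] using key

/-- **An element of `Π^tp_X` whose conjugation action on `Δ_X` is inner acts TRIVIALLY on the whole
abelianisation `Δ^ell_X = Δ_X/[Δ_X, Δ_X]⁻`** (`(d y d⁻¹)⁻¹ y = ⁅d, y⁻¹⁆ ∈ [Δ_X, Δ_X]`).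
[cite: MochizukiEtTh2009, §1 p.238] -/
theorem conjDeltaEll_eq_self_of_inner (g : D.Pi) (d : D.deltaHat)
    (hd : ∀ h : D.deltaHat, D.toHat g * (h : D.PiHat) * (D.toHat g)⁻¹ = d * h * (d : D.PiHat)⁻¹)
    (t : D.DeltaEll) : D.conjDeltaEll g t = t := by
  induction t using QuotientGroup.induction_on with
  | H y =>
    change QuotientGroup.map _ _ (D.conjDeltaHat g).toMonoidHom _ (QuotientGroup.mk y) = QuotientGroup.mk y
    rw [QuotientGroup.map_mk, QuotientGroup.eq, Subgroup.mem_subgroupOf]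
    have hcoe : ((D.conjDeltaHat g).toMonoidHom y : D.PiHat) = d * y * (d : D.PiHat)⁻¹ := by
      rw [MulEquiv.coe_toMonoidHom, coe_conjDeltaHat, hd]
    rw [Subgroup.coe_mul, Subgroup.coe_inv, hcoe]
    -- `(d y d⁻¹)⁻¹ y = ⁅d, y⁻¹⁆ ∈ [Δ̂, Δ̂] ≤ [Δ̂, Δ̂]⁻`
    have key : d * (y : D.PiHat)⁻¹ * (d : D.PiHat)⁻¹ * ((y : D.PiHat)⁻¹)⁻¹ ∈ D.ellKerHat :=
      Subgroup.le_topologicalClosure _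
        (Subgroup.commutator_mem_commutator d.2 (D.deltaHat.inv_mem y.2))
    simpa [mul_inv_rev, mul_assoc] using key

/-- **Tempered side**: an element `g ∈ Π^tp_X` whose conjugation action on `Δ_X` is inner acts TRIVIALLY
on `(Δ^tp_X)^ell ⊆ (Π^tp_X)^ell` (hence on `(Δ^tp_Y)^ell`): for `y ∈ Δ^tp_X`, `g y⁻¹ g⁻¹ y ∈ Δ^tp_X` maps
to `⁅d, ŷ⁻¹⁆ ∈ [Δ_X, Δ_X] ⊆ [Δ_X, Δ_X]⁻` in `Π_X`, i.e. lies in `Ker(Π^tp_X ↠ (Π^tp_X)^ell)`.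
[cite: MochizukiEtTh2009, §1 p.238] -/
theorem conjPiEll_eq_self_of_inner (g : D.Pi) (d : D.deltaHat)
    (hd : ∀ h : D.deltaHat, D.toHat g * (h : D.PiHat) * (D.toHat g)⁻¹ = d * h * (d : D.PiHat)⁻¹)
    {t : D.PiEll} (ht : t ∈ D.deltaTpEll) : D.conjPiEll g t = t := by
  obtain ⟨y, hy, rfl⟩ := ht
  change QuotientGroup.map _ _ (MulAut.conj g).toMonoidHom _ (QuotientGroup.mk y) = QuotientGroup.mk y
  rw [QuotientGroup.map_mk, QuotientGroup.eq]
  have hrew : ((MulAut.conj g).toMonoidHom y)⁻¹ * y = g * y⁻¹ * g⁻¹ * y := by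
    simp [MulAut.conj_apply, mul_inv_rev, mul_assoc]
  rw [hrew]
  change g * y⁻¹ * g⁻¹ * y ∈ D.delta ⊓ D.ellKerHat.comap D.toHat.toMonoidHom
  refine Subgroup.mem_inf.mpr ⟨?_, ?_⟩
  · -- in `Δ` (normal)
    exact D.delta.mul_mem (D.delta_normal.conj_mem _ (D.delta.inv_mem hy) g) hy
  · -- its image in `Π̂` is `⁅d, ŷ⁻¹⁆ ∈ [Δ̂, Δ̂]⁻`
    rw [Subgroup.mem_comap]
    have hyhat : (D.toHat y : D.PiHat)⁻¹ ∈ D.deltaHat :=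
      D.deltaHat.inv_mem (Subgroup.le_topologicalClosure _ ⟨y, hy, rfl⟩)
    have h1 : D.toHat.toMonoidHom (g * y⁻¹ * g⁻¹ * y) =
        D.toHat g * (D.toHat y)⁻¹ * (D.toHat g)⁻¹ * D.toHat y := by
      simp [map_mul, map_inv]
    rw [h1, hd ⟨_, hyhat⟩]
    have key : (d : D.PiHat) * (D.toHat y : D.PiHat)⁻¹ * (d : D.PiHat)⁻¹ * ((D.toHat y : D.PiHat)⁻¹)⁻¹ ∈
        D.ellKerHat :=
      Subgroup.le_topologicalClosure _ (Subgroup.commutator_mem_commutator d.2 hyhat)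
    simpa [mul_assoc] using key

/-- `(Δ^tp_Y)^ell ≤ (Δ^tp_X)^ell` in `(Π^tp_X)^ell` (`Δ^tp_Y = Δ^tp_X ∩ Π^tp_Y`).
[cite: MochizukiEtTh2009, §1 p.238] -/
theorem deltaYEll_le_deltaTpEll : D.deltaYEll ≤ D.deltaTpEll :=
  Subgroup.map_mono inf_le_left

/-- **No `Π^tp_X`-FIXED subgroup is a Tate twist `Ẑ(1)` once `G_K` moves a root of unity.** If `Π^tp_X`
acts trivially on `T` through `act`, while some `σ ∈ G_K` moves some `ζ ∈ μ_n(K̄)` (`n ≥ 1`), then `T` is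
not `Ẑ(1)` as a `G_K`-module in the sense of `IsTateTwist`: the level-`n` surjection `ι_n : T ↠ μ_n(K̄)`
hits `ζ = ι_n(t)`, `σ = aug(g)` for some `g` (`aug` is onto), and equivariance reads
`ζ = ι_n(g · t) = σ(ι_n(t)) = σ(ζ) ≠ ζ`. [cite: MochizukiEtTh2009, §1 p.238] -/
theorem not_isTateTwist_of_forall_eq {A : Type u} [Group A] [TopologicalSpace A] (T : Subgroup A)
    (act : D.Pi → A →* A) (hact : ∀ g, ∀ t ∈ T, act g t ∈ T) (htriv : ∀ g, ∀ t ∈ T, act g t = t)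
    {σ : Field.absoluteGaloisGroup K} {n : ℕ} (hn : 0 < n) {ζ : AlgebraicClosure K} (hζ : ζ ^ n = 1)
    (hσ : galApply σ ζ ≠ ζ) : ¬ D.IsTateTwist T act hact := by
  rintro ⟨ι, -, hsurj, -, -, -, hequiv⟩
  have hζ0 : ζ ≠ 0 := by
    rintro rfl
    rw [zero_pow hn.ne'] at hζ
    exact zero_ne_one hζ
  obtain ⟨t, ht⟩ := hsurj n hn (Units.mk0 ζ hζ0) (Units.ext (by simpa using hζ))
  obtain ⟨g, hg⟩ := D.aug_surjective σ
  have h := hequiv n hn g t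
  have hfix : (⟨act g t, hact g t t.2⟩ : T) = t := Subtype.ext (htriv g t t.2)
  rw [hfix, hg, ht] at h
  exact hσ (by simpa using h.symm)

/-- **`Δ^tp_X` acts trivially on `Δ_Θ`** (every `D`): for `g ∈ Δ^tp_X` the action on `Δ_X` is inner by
`ĝ ∈ Δ_X`, so `g` fixes `Δ_Θ` pointwise — the kernel form of "on the central subquotient `Δ_Θ` the
conjugation action of `Π^tp_X` factors through `Π^tp_X/Δ^tp_X = G_K`" (module docstring of
`TemperedCyclotomic.lean`; [EtTh] §1 p. 238, `Δ_Θ ≅ Ẑ(1)` "as a `G_K`-module").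
[cite: MochizukiEtTh2009, §1 p.238] -/
theorem conjDeltaThetaX_eq_self_of_mem_delta {g : D.Pi} (hg : g ∈ D.delta) {t : D.DeltaThetaX}
    (ht : t ∈ D.deltaTheta) : D.conjDeltaThetaX g t = t :=
  D.conjDeltaThetaX_eq_self_of_inner g ⟨D.toHat g, Subgroup.le_topologicalClosure _ ⟨g, hg, rfl⟩⟩
    (fun _ => rfl) ht

/-- **`Δ^tp_X` acts trivially on `Δ^ell_X`** (every `D`): the conjugation action of `Π^tp_X` on the
abelianisation `Δ^ell_X` factors through `G_K`. [cite: MochizukiEtTh2009, §1 p.238] -/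
theorem conjDeltaEll_eq_self_of_mem_delta {g : D.Pi} (hg : g ∈ D.delta) (t : D.DeltaEll) :
    D.conjDeltaEll g t = t :=
  D.conjDeltaEll_eq_self_of_inner g ⟨D.toHat g, Subgroup.le_topologicalClosure _ ⟨g, hg, rfl⟩⟩
    (fun _ => rfl) t

/-- **`Δ^tp_X` acts trivially on `(Δ^tp_X)^ell`** (every `D`): the conjugation action of `Π^tp_X` on
`(Δ^tp_X)^ell ⊇ (Δ^tp_Y)^ell` factors through `G_K` ([EtTh] §1 p. 239, "the natural surjection
`(Π^tp_Y)^ell ↠ G_K`" with abelian kernel). [cite: MochizukiEtTh2009, §1 pp.238-239] -/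
theorem conjPiEll_eq_self_of_mem_delta {g : D.Pi} (hg : g ∈ D.delta) {t : D.PiEll} (ht : t ∈ D.deltaTpEll) :
    D.conjPiEll g t = t :=
  D.conjPiEll_eq_self_of_inner g ⟨D.toHat g, Subgroup.le_topologicalClosure _ ⟨g, hg, rfl⟩⟩
    (fun _ => rfl) ht

/-! ### Instance forms: the predicates hold at every origin hypothesis with NO Tate-origin datum -/

/-- Instance form of F-0658: `DeltaThetaIsoTate Ω` HOLDS (vacuously) at every origin hypothesis `Ω` that
declares no datum to be `Π^tp_X` of the Tate curve — in particular at the empty origin. Honest label: the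
tree constructs no tempered fundamental group (FOUNDATIONS row 13), so no NON-vacuous instance is
available; the intended `Ω` is the one André's `π₁^temp` would supply. [cite: MochizukiEtTh2009, §1 p.238] -/
theorem deltaThetaIsoTate_of_forall_not_isTateOrigin (Ω : TemperedPiOrigin K)
    (hΩ : ∀ D : OncePuncturedTemperedGroup K, ¬ Ω.IsTateOrigin D) : DeltaThetaIsoTate Ω :=
  fun D hD => (hΩ D hD).elim

/-- Instance form of F-0657: `DeltaEllExtension Ω` holds (vacuously) at every origin hypothesis with no
Tate-origin datum. [cite: MochizukiEtTh2009, §1 p.238] -/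
theorem deltaEllExtension_of_forall_not_isTateOrigin (Ω : TemperedPiOrigin K)
    (hΩ : ∀ D : OncePuncturedTemperedGroup K, ¬ Ω.IsTateOrigin D) : DeltaEllExtension Ω :=
  fun D hD => (hΩ D hD).elim

/-- Instance form of F-0659: `DeltaYEllIsoTate Ω` holds (vacuously) at every origin hypothesis with no
Tate-origin datum. [cite: MochizukiEtTh2009, §1 p.238] -/
theorem deltaYEllIsoTate_of_forall_not_isTateOrigin (Ω : TemperedPiOrigin K)
    (hΩ : ∀ D : OncePuncturedTemperedGroup K, ¬ Ω.IsTateOrigin D) : DeltaYEllIsoTate Ω :=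
  fun D hD => (hΩ D hD).elim

/-- Instance form of F-1697: `DeltaYEllClosureIsoTate Ω` holds (vacuously) at every origin hypothesis with
no Tate-origin datum. [cite: MochizukiEtTh2009, §1 p.238] -/
theorem deltaYEllClosureIsoTate_of_forall_not_isTateOrigin (Ω : TemperedPiOrigin K)
    (hΩ : ∀ D : OncePuncturedTemperedGroup K, ¬ Ω.IsTateOrigin D) : DeltaYEllClosureIsoTate Ω :=
  fun D hD => (hΩ D hD).elim

end OncePuncturedTemperedGroup

/-! ### The universal closures are FALSE (schemas over the lawless origin binder `Ω`) -/

namespace OncePuncturedTemperedGroup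

open OncePuncturedTemperedGroup

/-- **At `K = ℚ₃`, the ALL-TRUE origin hypothesis violates `DeltaThetaIsoTate`** (F-0658): it declares the
product model `Π = Γ × G_{ℚ₃}` (`exists_model_padic_inner`) to be `Π^tp_X`; there every `g` acts on `Δ_X`
by an inner automorphism, hence trivially on `Δ_Θ` (`conjDeltaThetaX_eq_self_of_inner`), while `G_{ℚ₃}`
moves `i ∈ μ₄(Q̄₃)` (`exists_gal_moves_fourth_root_padic_three`) — so `Δ_Θ` is not `Ẑ(1)` as a
`G_{ℚ₃}`-module there (`not_isTateTwist_of_forall_eq`). [cite: MochizukiEtTh2009, §1 p.238] -/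
theorem exists_not_deltaThetaIsoTate : ∃ Ω : TemperedPiOrigin ℚ_[3], ¬ DeltaThetaIsoTate Ω := by
  obtain ⟨D, hD⟩ := OncePuncturedTemperedGroup.exists_model_padic_inner 3
  obtain ⟨σ, ζ, hζ, hσ⟩ := exists_gal_moves_fourth_root_padic_three
  refine ⟨⟨fun _ => True, fun _ => True, fun _ _ => trivial⟩, fun h => ?_⟩
  refine D.not_isTateTwist_of_forall_eq D.deltaTheta D.conjDeltaThetaX _ (fun g t ht => ?_)
    (by norm_num : 0 < 4) hζ hσ (h D trivial)
  obtain ⟨d, hd⟩ := hD g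
  exact D.conjDeltaThetaX_eq_self_of_inner g d hd ht

/-- **F-0658 — the universal closure of `DeltaThetaIsoTate` is FALSE** (a schema over the lawless origin
binder `Ω : TemperedPiOrigin K`; cell rule R5: consumed AT NAMED INSTANCES only). Witness: `K = ℚ₃`,
`exists_not_deltaThetaIsoTate`. A statement about OUR typed predicate (which data `Ω` may declare to be
`Π^tp_X`), not about [EtTh] §1. [cite: MochizukiEtTh2009, §1 p.238] -/
theorem not_forall_deltaThetaIsoTate :
    ¬ ∀ (K : Type) [Field K] (Ω : TemperedPiOrigin K), DeltaThetaIsoTate Ω := fun h => by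
  obtain ⟨Ω, hΩ⟩ := exists_not_deltaThetaIsoTate
  exact hΩ (h ℚ_[3] Ω)

/-- **At `K = ℚ₃`, the all-true origin hypothesis violates `DeltaYEllIsoTate`** (F-0659): in the product
model every `g ∈ Π^tp_X` acts trivially on `(Δ^tp_X)^ell ⊇ (Δ^tp_Y)^ell` (`conjPiEll_eq_self_of_inner`),
while `G_{ℚ₃}` moves `i ∈ μ₄(Q̄₃)`. [cite: MochizukiEtTh2009, §1 p.238] -/
theorem exists_not_deltaYEllIsoTate : ∃ Ω : TemperedPiOrigin ℚ_[3], ¬ DeltaYEllIsoTate Ω := by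
  obtain ⟨D, hD⟩ := OncePuncturedTemperedGroup.exists_model_padic_inner 3
  obtain ⟨σ, ζ, hζ, hσ⟩ := exists_gal_moves_fourth_root_padic_three
  refine ⟨⟨fun _ => True, fun _ => True, fun _ _ => trivial⟩, fun h => ?_⟩
  refine D.not_isTateTwist_of_forall_eq D.deltaYEll D.conjPiEll _ (fun g t ht => ?_)
    (by norm_num : 0 < 4) hζ hσ (h D trivial)
  obtain ⟨d, hd⟩ := hD g
  exact D.conjPiEll_eq_self_of_inner g d hd (D.deltaYEll_le_deltaTpEll ht)

/-- **F-0659 — the universal closure of `DeltaYEllIsoTate` is FALSE** (schema over the origin binder;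
witness `K = ℚ₃`, `exists_not_deltaYEllIsoTate`). [cite: MochizukiEtTh2009, §1 p.238] -/
theorem not_forall_deltaYEllIsoTate :
    ¬ ∀ (K : Type) [Field K] (Ω : TemperedPiOrigin K), DeltaYEllIsoTate Ω := fun h => by
  obtain ⟨Ω, hΩ⟩ := exists_not_deltaYEllIsoTate
  exact hΩ (h ℚ_[3] Ω)

/-- **At `K = ℚ₃`, the all-true origin hypothesis violates `DeltaEllExtension`** (F-0657): in the product
model every `g ∈ Π^tp_X` acts trivially on ALL of `Δ^ell_X` (`conjDeltaEll_eq_self_of_inner`), so no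
`Π^tp_X`-stable subgroup `T ≤ Δ^ell_X` is a Tate twist `Ẑ(1)` while `G_{ℚ₃}` moves `i ∈ μ₄(Q̄₃)`; in
particular the asserted `1 → Ẑ(1) → Δ^ell_X → Ẑ → 1` has no kernel term there.
[cite: MochizukiEtTh2009, §1 p.238] -/
theorem exists_not_deltaEllExtension : ∃ Ω : TemperedPiOrigin ℚ_[3], ¬ DeltaEllExtension Ω := by
  obtain ⟨D, hD⟩ := OncePuncturedTemperedGroup.exists_model_padic_inner 3
  obtain ⟨σ, ζ, hζ, hσ⟩ := exists_gal_moves_fourth_root_padic_three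
  refine ⟨⟨fun _ => True, fun _ => True, fun _ _ => trivial⟩, fun h => ?_⟩
  obtain ⟨T, hT, -, htw, -⟩ := h D trivial
  refine D.not_isTateTwist_of_forall_eq T D.conjDeltaEll hT (fun g t _ => ?_)
    (by norm_num : 0 < 4) hζ hσ htw
  obtain ⟨d, hd⟩ := hD g
  exact D.conjDeltaEll_eq_self_of_inner g d hd t

/-- **F-0657 — the universal closure of `DeltaEllExtension` is FALSE** (schema over the origin binder;
witness `K = ℚ₃`, `exists_not_deltaEllExtension`). [cite: MochizukiEtTh2009, §1 p.238] -/
theorem not_forall_deltaEllExtension :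
    ¬ ∀ (K : Type) [Field K] (Ω : TemperedPiOrigin K), DeltaEllExtension Ω := fun h => by
  obtain ⟨Ω, hΩ⟩ := exists_not_deltaEllExtension
  exact hΩ (h ℚ_[3] Ω)

/-- **At `K = ℚ₃`, the all-true origin hypothesis violates `DeltaYEllClosureIsoTate`** (F-1697): as for
F-0657 — no `Π^tp_X`-stable subgroup of `Δ^ell_X` of the product model is a Tate twist, in particular not
the closure of the image of `Δ^tp_Y`. [cite: MochizukiEtTh2009, §1 p.238] -/
theorem exists_not_deltaYEllClosureIsoTate :
    ∃ Ω : TemperedPiOrigin ℚ_[3], ¬ DeltaYEllClosureIsoTate Ω := by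
  obtain ⟨D, hD⟩ := OncePuncturedTemperedGroup.exists_model_padic_inner 3
  obtain ⟨σ, ζ, hζ, hσ⟩ := exists_gal_moves_fourth_root_padic_three
  refine ⟨⟨fun _ => True, fun _ => True, fun _ _ => trivial⟩, fun h => ?_⟩
  obtain ⟨T, hT, -, htw, -⟩ := h D trivial
  refine D.not_isTateTwist_of_forall_eq T D.conjDeltaEll hT (fun g t _ => ?_)
    (by norm_num : 0 < 4) hζ hσ htw
  obtain ⟨d, hd⟩ := hD g
  exact D.conjDeltaEll_eq_self_of_inner g d hd t

/-- **F-1697 — the universal closure of `DeltaYEllClosureIsoTate` is FALSE** (schema over the origin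
binder; witness `K = ℚ₃`, `exists_not_deltaYEllClosureIsoTate`). [cite: MochizukiEtTh2009, §1 p.238] -/
theorem not_forall_deltaYEllClosureIsoTate :
    ¬ ∀ (K : Type) [Field K] (Ω : TemperedPiOrigin K), DeltaYEllClosureIsoTate Ω := fun h => by
  obtain ⟨Ω, hΩ⟩ := exists_not_deltaYEllClosureIsoTate
  exact hΩ (h ℚ_[3] Ω)

end OncePuncturedTemperedGroup

end Literature.AnabelianGeometry.SemiGraphs

end
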